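import Literature.Barriers.CriticalPhenomena.PlaquetteWalkHoleRootLawLDichotomy
import Literature.Barriers.CriticalPhenomena.PlaquetteWalkIsthmusDefect
import HarnessLib

/-!
# Barrier catalogue (SAWScalingLimit): THIN SIDE — when the cell below the far cell's southern neighbour is absent, the
under route carries NO wound walk; a hole one row above the bottom wall forces `Im VF > 0` at BOTH hexagonal angles

Leaf of `PlaquetteWalkHoleRootLawLDichotomy` (boxes, block witnesses at every position, the mids-shift transport). The
structural kills of `PlaquetteWalkHoleRootStructuralKillQuadrant` say: hole and `K_S2 = (w.1 − 3, w.2 − 2)` absent, no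
usable western door of the far cell's column below the kill row ⇒ every WOUND class-`B2a` under-walk at the far cell
carries TWO `(π − θ)`-corner arcs in the cell `farSW w = (w.1 − 2, w.2 − 1)` below the far cell (`ΩG.kindsIn_farSW_eq_of_
wound_under_quadrant`). Two co-corner arcs of one rhombus occupy all four of its sides, so one of them passes through the
`S` side of `farSW w`, whose other face is `(w.1 − 2, w.2 − 2)`. §1: if THAT cell is absent too, no wound under-walk
exists at all (★★★ `ΩG.WE_eq_excursionWinding_of_under_thinS` — the under route is EMPTY; e.g. every domain whose cells
all lie in rows `≥ w.2 − 1`: a box with the hole ONE row above the bottom wall), and by the row mirror the same for the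
over route when `(w.1 − 2, w.2 + 2)` and `K_N1` are absent (`ΩG.WE_eq_excursionWinding_of_over_thinN`). §2: the schema
leaf's two OVER witnesses re-drawn on their own 16/17-cell blocks (rows `w.2 − 1 … w.2 + 2` only: `overBlockW42`,
`overBlockE42`) and carried to every position (`exists_over_w2free_of_overBlockW`, `exists_over_w1free_of_overBlockE`).
§3: hence, with the hole, `K_S2`, the cell below `farSW` absent and the two over blocks present, the far-cell defect has
★★★★ `Im VF(π/3) > 0` AND `Im VF(2π/3) > 0` (`im_vertexFunctional_printed_{pi,two_pi}_div_three_pos_of_thinS`) — the SAME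
strict sign at both ends of the hexagonal range, in contrast with the kill-forced sign change of LAW L — and
★★★★★ `Im VF(θ) > 0` for EVERY `θ ∈ [π/3, 2π/3]` (`im_vertexFunctional_printed_pos_of_thinS`: the under route mass
vanishes identically, `ΩG.sum_routeMassW_S_eq_zero_of_thinS`, and every walk weighs positively in the open range,
`ΩG.extWeight_pos_of_mem_Ioo`, `ΩG.sum_routeMassW_pos_of_wound`) — so the far-cell vertex functional has NO ZERO on the
hexagonal range (`vertexFunctional_printed_ne_zero_of_thinS`); §4, all boxes (also ★★★★★ `thinBox_im_pos`,
`thinBox_vertexFunctional_ne_zero`); §5: BOTH sides thin (a height-three strip with the hole in the middle row)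
⇒ both routes empty ⇒ the vertex functional VANISHES at the far cell for every θ ∈ [π/3, 2π/3]
(`vertexFunctional_printed_eq_zero_of_thinS_thinN`, `stripThreeBox_vertexFunctional_eq_zero`); §4 boxes:
`thinBox_im_pi_div_three_pos` / `thinBox_im_two_pi_div_three_pos` — the `m × n` box (`n ≥ 4`) with the hole at `(h.1, 1)`,
one row above the bottom wall, `2 ≤ h.1`, `h.1 + 3 ≤ m`. (Hub datum of the lane, `DESIGN-next-g26.md` §2 item 2: no wound
under-walk in `7 × 4`; here it is a theorem for every domain.)

Not in print; venture lane «pcv-sawmu», seat b-step0 gen 26.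

References: A. Glazman, I. Manolescu, arXiv:1708.00395v3, §1 (Fig. 1, Fig. 2), §2.1, §4.2 and Lemma 2.1
[GlazmanManolescu2019]; A. Glazman, Electron. Commun. Probab. 20 (2015) no. 86, Lemma 3.1, proof pp. 6–7
[Glazman2015WeightedSAW]; R. Courant, H. Robbins, *What is Mathematics?* (1941/1958), Ch. V Appendix §2 (the even–odd
rule) [CourantRobbins1958].
-/

noncomputable section

open Set Function Complex

namespace Literature.Probability.RandomPlanarGeometry.SAW.YangBaxter

open Real
open Literature.Barriers.CriticalPhenomena.PlaquetteWalk (mirrorRowFace mirrorRowFace_mirrorRowFace)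

/-! ## §1 The under route is empty when the cell below `farSW` is absent -/

section ThinCells

variable (w : Face)

/-- The faces of the bottom side of the cell below the far cell. [cite: GlazmanManolescu2019, §1 (the lattice of rhombi and its mid-edges)] -/
private theorem farSW_side_S_faces_thin : ((farSW w).side .S).faces = (((w.1 - 2, w.2 - 2) : Face), farSW w) := by
  obtain ⟨a, b⟩ := w
  simp only [farSW, Face.side, MidEdge.faces, Prod.mk.injEq, and_true, true_and]
  ring

/-- The root is not the bottom side of the cell below the far cell. [cite: GlazmanManolescu2019, §1 (the lattice of rhombi and its mid-edges)] -/
theorem root_ne_farSW_side_S : w.side .W ≠ (farSW w).side .S := by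
  obtain ⟨a, b⟩ := w; simp [farSW, Face.side]

/-- No side of the far cell is the bottom side of the cell below it. [cite: GlazmanManolescu2019, §1 (the lattice of rhombi and its mid-edges)] -/
theorem farW_side_ne_farSW_side_S (s : Side) : (farW w).side s ≠ (farSW w).side .S := by
  obtain ⟨a, b⟩ := w
  cases s <;> simp only [farW, farSW, Face.side, ne_eq, MidEdge.slant.injEq, reduceCtorEq, not_false_eq_true,
    true_and] <;> omega

variable {w}

/-- A co-corner arc avoiding the `S` side passes through the `N` side. [cite: GlazmanManolescu2019, §1, Fig. 1 (the two (π − θ)-corner arcs)] -/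
theorem coCorner_side_N_of_ne_S {s t : Side} (hc : arcKind s t = .coCorner) (hs : s ≠ .S) (ht : t ≠ .S) :
    s = .N ∨ t = .N := by
  revert hc hs ht; cases s <;> cases t <;> decide

end ThinCells

namespace ΩG

variable {D : Set Face} {w : Face}

/-- ★★★ **THE UNDER ROUTE IS EMPTY ON A THIN SIDE.** Hole, `K_S2` and the cell `(w.1 − 2, w.2 − 2)` below `farSW w`
absent, and no western door of the far cell's column below the kill row (all of this holds when no cell of the domain lies
in the rows `≤ w.2 − 2` near the hole — a hole ONE row above the bottom wall): then NO class-`B2a` under-walk at the far cell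
is wound, at any angle. (A wound one would carry two co-corner arcs in `farSW w` by the quadrant kill; they fill the four
sides of that rhombus, so one crosses its `S` side — a door onto the absent cell.)
[cite: GlazmanManolescu2019, §1 (Fig. 1, Fig. 2), Lemma 2.1] [cite: Glazman2015WeightedSAW, Lemma 3.1 (proof, pp. 6–7)]
[cite: CourantRobbins1958, Ch. V Appendix §2 (the even–odd rule)] -/
theorem WE_eq_excursionWinding_of_under_thinS (hh : holeFaceW w ∉ D) (hK : killSW w ∉ D)
    (hcol : ∀ y : ℤ, y ≤ w.2 - 3 → (w.1 - 3, y) ∉ D ∨ (w.1 - 2, y) ∉ D)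
    (hB : ((w.1 - 2, w.2 - 2) : Face) ∉ D)
    (ω : ΩG D (w.side .W) (farW w)) (hr : RootedFace D (w.side .W) (farW w)) (h : ω.IsB2a)
    (hS : ω.2.firstSideG = .S) (θ : ℝ) :
    ω.WE (fun _ => θ) = excursionWinding θ ω.2.firstSideG (ω.z1 hr h) ω.1 := by
  by_contra hW
  have hk := ω.kindsIn_farSW_eq_of_wound_under_quadrant hh hK
    (fun y hy => (hcol y hy).elim Or.inl fun h' => Or.inr (Or.inl h')) hr h hS hW
  obtain ⟨i, j, hij, hj, hfi, hfj⟩ :=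
    ω.2.exists_two_arcs_of_two_le_length_kindsIn (f := farSW w) (by rw [hk]; simp)
  have hi : i < ω.2.arcs.length := by omega
  -- both arcs in `farSW w` are co-corner arcs
  have hcc : ∀ {k : ℕ} (hk' : k < ω.2.arcs.length), ω.2.fc k = farSW w →
      arcKind (ω.2.sIn k) (ω.2.sOut k) = .coCorner := by
    intro k hk' hfk
    have hm := ω.2.arcKind_mem_kindsIn hk'
    rw [hfk, hk] at hm
    simpa using hm
  -- no arc in `farSW w` passes through its `S` side (the cell below is absent)
  have noS : ∀ {k : ℕ} (hk' : k < ω.2.arcs.length), ω.2.fc k = farSW w → ω.2.sIn k ≠ .S ∧ ω.2.sOut k ≠ .S := by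
    intro k hk' hfk
    obtain ⟨h1, h2, -⟩ := ω.2.side_sIn_nth hk'
    rw [hfk] at h1 h2
    constructor
    · intro e
      rw [e] at h1
      have hk0 : 0 < k := by
        rcases Nat.eq_zero_or_pos k with e0 | hpos
        · exfalso
          rw [e0, YBWalk.nth_zero] at h1
          exact root_ne_farSW_side_S w h1.symm
        · exact hpos
      have hd := ω.2.door_nth hk0 hk'
      rw [← h1, farSW_side_S_faces_thin] at hd
      exact hB hd.1
    · intro e
      rw [e] at h2
      rcases Nat.lt_or_ge (k + 1) ω.2.arcs.length with hlt | hge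
      · have hd := ω.2.door_nth (j := k + 1) (by omega) hlt
        rw [← h2, farSW_side_S_faces_thin] at hd
        exact hB hd.1
      · have ek : k + 1 = ω.2.arcs.length := by omega
        rw [ek, YBWalk.nth_length] at h2
        exact farW_side_ne_farSW_side_S w ω.1 h2.symm
  -- so both arcs pass through the `N` side: the same mid-edge at two different indices
  have hN : ∀ {k : ℕ} (hk' : k < ω.2.arcs.length), ω.2.fc k = farSW w →
      ω.2.nth k = (farSW w).side .N ∨ ω.2.nth (k + 1) = (farSW w).side .N := by
    intro k hk' hfk
    obtain ⟨h1, h2, -⟩ := ω.2.side_sIn_nth hk'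
    rw [hfk] at h1 h2
    obtain ⟨n1, n2⟩ := noS hk' hfk
    rcases coCorner_side_N_of_ne_S (hcc hk' hfk) n1 n2 with e | e
    · left; rw [← h1, e]
    · right; rw [← h2, e]
  have hij1 : i + 1 ≠ j := by
    intro e
    have hne := ω.2.fc_succ_ne (i := i) (by omega)
    rw [e, hfi, hfj] at hne
    exact hne rfl
  have hn := ω.2.length_arcs
  rcases hN hi hfi with ei | ei <;> rcases hN hj hfj with ej | ej
  · have := ω.2.nth_inj (by omega) (by omega) (ei.trans ej.symm); omega
  · have := ω.2.nth_inj (by omega) (by omega) (ei.trans ej.symm); omega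
  · have := ω.2.nth_inj (by omega) (by omega) (ei.trans ej.symm); omega
  · have := ω.2.nth_inj (by omega) (by omega) (ei.trans ej.symm); omega

/-- ★★★ «Every wound under-walk is `w₂`-marked» and «… is `w₁`-marked» both hold VACUOUSLY on a thin side.
[cite: GlazmanManolescu2019, §1 (Fig. 2 and the remark after eq. (1))] -/
theorem under_killed_both_of_thinS (hh : holeFaceW w ∉ D) (hK : killSW w ∉ D)
    (hcol : ∀ y : ℤ, y ≤ w.2 - 3 → (w.1 - 3, y) ∉ D ∨ (w.1 - 2, y) ∉ D)
    (hB : ((w.1 - 2, w.2 - 2) : Face) ∉ D) (hr : RootedFace D (w.side .W) (farW w)) (θ : ℝ) :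
    (∀ (ω : ΩG D (w.side .W) (farW w)) (h : ω.IsB2a), ω.2.firstSideG = .S →
        ω.WE (fun _ => θ) ≠ excursionWinding θ ω.2.firstSideG (ω.z1 hr h) ω.1 → ¬ω.2.W2FreeOff (farW w)) ∧
      (∀ (ω : ΩG D (w.side .W) (farW w)) (h : ω.IsB2a), ω.2.firstSideG = .S →
        ω.WE (fun _ => θ) ≠ excursionWinding θ ω.2.firstSideG (ω.z1 hr h) ω.1 → ¬ω.2.W1FreeOff (farW w)) :=
  ⟨fun ω h hS hW => absurd (WE_eq_excursionWinding_of_under_thinS hh hK hcol hB ω hr h hS θ) hW,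
    fun ω h hS hW => absurd (WE_eq_excursionWinding_of_under_thinS hh hK hcol hB ω hr h hS θ) hW⟩

/-- ★★★ **THE UNDER ROUTE MASS VANISHES IDENTICALLY ON A THIN SIDE** — at EVERY angle of the hexagonal range (no walk of
the route is wound). [cite: GlazmanManolescu2019, Lemma 2.1 (statement, "in the form given in [Gl]")] -/
theorem sum_routeMassW_S_eq_zero_of_thinS [Finite D] (hh : holeFaceW w ∉ D) (hK : killSW w ∉ D)
    (hcol : ∀ y : ℤ, y ≤ w.2 - 3 → (w.1 - 3, y) ∉ D ∨ (w.1 - 2, y) ∉ D)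
    (hB : ((w.1 - 2, w.2 - 2) : Face) ∉ D) (hr : RootedFace D (w.side .W) (farW w)) (θ : ℝ) :
    ∑ ω ∈ setB2a D (w.side .W) (farW w), routeMassW θ hr .S ω = 0 := by
  classical
  refine Finset.sum_eq_zero fun ω _ => ?_
  unfold routeMassW
  split_ifs with h1 h2
  · exact absurd (WE_eq_excursionWinding_of_under_thinS hh hK hcol hB ω hr h1 h2.1 θ) h2.2
  · rfl
  · rfl

/-- **In the OPEN hexagonal range every local weight of a drawn rhombus is positive** (`1, u₁, u₂, v, w₁, w₂ > 0` on
`(π/3, 2π/3)`; the six shapes of `kindsIn_shape`). [cite: GlazmanManolescu2019, §1, eq. (1) and Fig. 2] -/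
theorem localWeight_pos_of_shape {θ : ℝ} (hθ : θ ∈ Set.Ioo (π / 3) (2 * π / 3)) {l : List ArcKind}
    (hl : l = [] ∨ l = [.corner] ∨ l = [.coCorner] ∨ l = [.straight] ∨ l = [.corner, .corner] ∨
      l = [.coCorner, .coCorner]) : 0 < localWeight θ l := by
  have hθ' : θ ∈ Set.Icc (π / 3) (2 * π / 3) := ⟨hθ.1.le, hθ.2.le⟩
  have hpi := Real.pi_pos
  rcases hl with rfl | rfl | rfl | rfl | rfl | rfl
  · exact zero_lt_one
  · exact weightU1_pos hθ'
  · exact weightU2_pos hθ'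
  · exact weightV_pos_of_mem_Ioo ⟨by linarith [hθ.1], by linarith [hθ.2]⟩
  · exact Literature.Barriers.CriticalPhenomena.PlaquetteWalk.weightW1_pos_of_mem hθ' hθ.2
  · exact Literature.Barriers.CriticalPhenomena.PlaquetteWalk.weightW2_pos_of_mem hθ' hθ.1

/-- **In the open hexagonal range every walk has positive exterior weight.** [cite: GlazmanManolescu2019, §1, eq. (1)] -/
theorem extWeight_pos_of_mem_Ioo {a z : MidEdge} (γ : YBWalk D a z) (r : Face) {θ : ℝ}
    (hθ : θ ∈ Set.Ioo (π / 3) (2 * π / 3)) : 0 < γ.extWeight (fun _ => θ) r := by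
  unfold YBWalk.extWeight
  exact Finset.prod_pos fun g _ => localWeight_pos_of_shape hθ (γ.kindsIn_shape g)

/-- **A route with a wound walk has POSITIVE mass at every angle of the open hexagonal range** (no freeness needed away
from the endpoints). [cite: GlazmanManolescu2019, Lemma 2.1 (statement, "in the form given in [Gl]"), eq. (1)] -/
theorem sum_routeMassW_pos_of_wound [Finite D] (hr : RootedFace D (w.side .W) (farW w)) (s : Side) {θ : ℝ}
    (hθ : θ ∈ Set.Ioo (π / 3) (2 * π / 3))
    (hF : ∃ (ω : ΩG D (w.side .W) (farW w)) (h : ω.IsB2a), ω.2.firstSideG = s ∧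
      ω.WE (fun _ => θ) ≠ excursionWinding θ ω.2.firstSideG (ω.z1 hr h) ω.1) :
    0 < ∑ ω ∈ setB2a D (w.side .W) (farW w), routeMassW θ hr s ω := by
  classical
  have hθ' : θ ∈ Set.Icc (π / 3) (2 * π / 3) := ⟨hθ.1.le, hθ.2.le⟩
  obtain ⟨ω₀, h₀, hz₀, hW₀⟩ := hF
  have hmem : ω₀ ∈ setB2a D (w.side .W) (farW w) := by
    simp only [setB2a, Finset.mem_filter, Finset.mem_univ, true_and]; exact h₀
  refine lt_of_lt_of_le ?_ (Finset.single_le_sum (fun ω _ => routeMassW_nonneg hθ' hr s ω) hmem)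
  unfold routeMassW
  rw [dif_pos h₀, if_pos ⟨hz₀, hW₀⟩]
  exact extWeight_pos_of_mem_Ioo ω₀.2 _ hθ

/-- The reflection on a cell, in coordinates. [cite: GlazmanManolescu2019, §4.2 (lattice symmetries)] -/
private theorem mirrorRowFace_mkT (w : Face) (x y : ℤ) : mirrorRowFace w.2 ((x, y) : Face) = (x, 2 * w.2 - y) := by
  simp [mirrorRowFace]

/-- ★★★ **THE OVER ROUTE IS EMPTY ON A THIN TOP SIDE** (row mirror): hole, `K_N1` and the cell `(w.1 − 2, w.2 + 2)` above
`farNW w` absent, no western door of the far cell's column above the kill row ⇒ no class-`B2a` over-walk at the far cell is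
wound. [cite: GlazmanManolescu2019, §1 (Fig. 1, Fig. 2), §4.2 (lattice symmetries), Lemma 2.1]
[cite: Glazman2015WeightedSAW, Lemma 3.1 (proof, pp. 6–7)] [cite: CourantRobbins1958, Ch. V Appendix §2 (the even–odd rule)] -/
theorem WE_eq_excursionWinding_of_over_thinN (hh : holeFaceW w ∉ D) (hK : killNW w ∉ D)
    (hcol : ∀ y : ℤ, w.2 + 3 ≤ y → (w.1 - 3, y) ∉ D ∨ (w.1 - 2, y) ∉ D)
    (hB : ((w.1 - 2, w.2 + 2) : Face) ∉ D)
    (ω : ΩG D (w.side .W) (farW w)) (hr : RootedFace D (w.side .W) (farW w)) (h : ω.IsB2a)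
    (hN : ω.2.firstSideG = .N) (θ : ℝ) :
    ω.WE (fun _ => θ) = excursionWinding θ ω.2.firstSideG (ω.z1 hr h) ω.1 := by
  by_contra hW
  have hr' := rootedFace_rowMirrorDom w hr
  have h' := ω.mirrorFar_isB2a hr h
  have hh' : holeFaceW w ∉ rowMirrorDom w D := by rwa [mem_rowMirrorDom, mirrorRowFace_holeFaceW]
  have hK' : killSW w ∉ rowMirrorDom w D := by rwa [mem_rowMirrorDom, mirrorRowFace_killSW]
  have hcol' : ∀ y : ℤ, y ≤ w.2 - 3 → (w.1 - 3, y) ∉ rowMirrorDom w D ∨ (w.1 - 2, y) ∉ rowMirrorDom w D := by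
    intro y hy
    simp only [mem_rowMirrorDom, mirrorRowFace_mkT]
    exact hcol (2 * w.2 - y) (by omega)
  have hB' : ((w.1 - 2, w.2 - 2) : Face) ∉ rowMirrorDom w D := by
    rw [mem_rowMirrorDom, mirrorRowFace_mkT, show 2 * w.2 - (w.2 - 2) = w.2 + 2 by ring]; exact hB
  have hS' : ω.mirrorFar.2.firstSideG = .S := by rw [mirrorFar_firstSideG, hN]; rfl
  exact absurd (WE_eq_excursionWinding_of_under_thinS hh' hK' hcol' hB' ω.mirrorFar hr' h' hS' _)
    (ω.mirrorFar_wound hr h hW)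

/-- ★★★ Both over-route kill statements hold VACUOUSLY on a thin top side. [cite: GlazmanManolescu2019, §1 (Fig. 2 and the remark after eq. (1))] -/
theorem over_killed_both_of_thinN (hh : holeFaceW w ∉ D) (hK : killNW w ∉ D)
    (hcol : ∀ y : ℤ, w.2 + 3 ≤ y → (w.1 - 3, y) ∉ D ∨ (w.1 - 2, y) ∉ D)
    (hB : ((w.1 - 2, w.2 + 2) : Face) ∉ D) (hr : RootedFace D (w.side .W) (farW w)) (θ : ℝ) :
    (∀ (ω : ΩG D (w.side .W) (farW w)) (h : ω.IsB2a), ω.2.firstSideG = .N →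
        ω.WE (fun _ => θ) ≠ excursionWinding θ ω.2.firstSideG (ω.z1 hr h) ω.1 → ¬ω.2.W2FreeOff (farW w)) ∧
      (∀ (ω : ΩG D (w.side .W) (farW w)) (h : ω.IsB2a), ω.2.firstSideG = .N →
        ω.WE (fun _ => θ) ≠ excursionWinding θ ω.2.firstSideG (ω.z1 hr h) ω.1 → ¬ω.2.W1FreeOff (farW w)) :=
  ⟨fun ω h hN hW => absurd (WE_eq_excursionWinding_of_over_thinN hh hK hcol hB ω hr h hN θ) hW,
    fun ω h hN hW => absurd (WE_eq_excursionWinding_of_over_thinN hh hK hcol hB ω hr h hN θ) hW⟩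

/-- ★★★ The over route mass vanishes identically on a thin TOP side, at every angle. [cite: GlazmanManolescu2019, Lemma 2.1 (statement, "in the form given in [Gl]")] -/
theorem sum_routeMassW_N_eq_zero_of_thinN [Finite D] (hh : holeFaceW w ∉ D) (hK : killNW w ∉ D)
    (hcol : ∀ y : ℤ, w.2 + 3 ≤ y → (w.1 - 3, y) ∉ D ∨ (w.1 - 2, y) ∉ D)
    (hB : ((w.1 - 2, w.2 + 2) : Face) ∉ D) (hr : RootedFace D (w.side .W) (farW w)) (θ : ℝ) :
    ∑ ω ∈ setB2a D (w.side .W) (farW w), routeMassW θ hr .N ω = 0 := by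
  classical
  refine Finset.sum_eq_zero fun ω _ => ?_
  unfold routeMassW
  split_ifs with h1 h2
  · exact absurd (WE_eq_excursionWinding_of_over_thinN hh hK hcol hB ω hr h1 h2.1 θ) h2.2
  · rfl
  · rfl

end ΩG

end Literature.Probability.RandomPlanarGeometry.SAW.YangBaxter

namespace Literature.Barriers.CriticalPhenomena.PlaquetteWalk

open Literature.Probability.RandomPlanarGeometry.SAW.YangBaxter
open Real Complex

/-! ## §2 The two over witnesses on their own blocks (rows `w.2 − 1 … w.2 + 2` only), every position -/

section OverBlocks

/-- The 16 cells visited by the schema leaf's `w₂`-free over witness (`deadEndOverMids`): rows `1 … 4` only.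
[cite: GlazmanManolescu2019, §2.1 (finite domains of faces)] -/
def overBlockW42 : List Face :=
  [(1,2),(1,3),(2,1),(2,2),(2,3),(2,4),(3,1),(3,3),(3,4),(4,1),(4,2),(4,3),(4,4),(5,2),(5,3),(5,4)]

/-- The 17 cells visited by the schema leaf's `w₁`-free over witness (`overMids`): rows `1 … 4` only.
[cite: GlazmanManolescu2019, §2.1 (finite domains of faces)] -/
def overBlockE42 : List Face :=
  [(1,2),(1,3),(1,4),(2,1),(2,2),(2,3),(2,4),(3,1),(3,3),(3,4),(4,1),(4,2),(4,3),(4,4),(5,1),(5,2),(5,3)]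

/-- The `w₂`-free over witness drawn in its own block. [cite: GlazmanManolescu2019, §1 (definition of the model), Fig. 1] -/
def overW42 : YBWalk (dom overBlockW42) (w42.side .W) ((farW w42).side .S) where
  mids := deadEndOverMids
  head_eq := by decide
  getLast_eq := by decide
  nodup := by decide
  arc_mem := arc_mem_of_check (by decide)
  isChain := by decide
  noncross := noncross_of_check (by decide)

/-- The `w₁`-free over witness drawn in its own block. [cite: GlazmanManolescu2019, §1 (definition of the model), Fig. 1] -/
def overE42 : YBWalk (dom overBlockE42) (w42.side .W) ((farW w42).side .S) where
  mids := overMids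
  head_eq := by decide
  getLast_eq := by decide
  nodup := by decide
  arc_mem := arc_mem_of_check (by decide)
  isChain := by decide
  noncross := noncross_of_check (by decide)

/-- The labelled `w₂`-free over witness. [cite: Glazman2015WeightedSAW, Lemma 3.1 (proof, pp. 6–7)] -/
def ωOW : ΩG (dom overBlockW42) (w42.side .W) (farW w42) := ⟨.S, overW42⟩

/-- The labelled `w₁`-free over witness. [cite: Glazman2015WeightedSAW, Lemma 3.1 (proof, pp. 6–7)] -/
def ωOE : ΩG (dom overBlockE42) (w42.side .W) (farW w42) := ⟨.S, overE42⟩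

/-- Certificates of the `w₂`-free over witness on its own block. [cite: Glazman2015WeightedSAW, Lemma 3.1 (proof, pp. 6–7)]
[cite: CourantRobbins1958, Ch. V Appendix §2 (the even–odd rule)] -/
theorem ωOW_cert : ωOW.2.firstHitG = 4 ∧ ωOW.2.arcs.length = 18 ∧ (∀ j < 18, 4 < j → ωOW.2.fc j ≠ farW w42) ∧
    ωOW.2.nth 4 = (farW w42).side .N ∧ ωOW.2.W2FreeOff (farW w42) ∧
    Odd ((Finset.range 14).filter fun j => eastRayB w42 (ωOW.2.nth (4 + j + 1)) = true).card := by
  refine ⟨by decide, by decide, by decide, by decide, by unfold YBWalk.W2FreeOff; decide, by decide⟩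

/-- Certificates of the `w₁`-free over witness on its own block. [cite: Glazman2015WeightedSAW, Lemma 3.1 (proof, pp. 6–7)]
[cite: CourantRobbins1958, Ch. V Appendix §2 (the even–odd rule)] -/
theorem ωOE_cert : ωOE.2.firstHitG = 4 ∧ ωOE.2.arcs.length = 18 ∧ (∀ j < 18, 4 < j → ωOE.2.fc j ≠ farW w42) ∧
    ωOE.2.nth 4 = (farW w42).side .N ∧ ωOE.2.W1FreeOff (farW w42) ∧
    Odd ((Finset.range 14).filter fun j => eastRayB w42 (ωOE.2.nth (4 + j + 1)) = true).card := by
  refine ⟨by decide, by decide, by decide, by decide, by unfold YBWalk.W1FreeOff; decide, by decide⟩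

/-- The `w₂`-free over witness's block at the root plaquette `w`. [cite: GlazmanManolescu2019, §2.1, §4.2 (translation invariance)] -/
def overBlockW (w : Face) : List Face := overBlockW42.map (Face.shiftBy (refShift w))

/-- The `w₁`-free over witness's block at `w`. [cite: GlazmanManolescu2019, §2.1, §4.2 (translation invariance)] -/
def overBlockE (w : Face) : List Face := overBlockE42.map (Face.shiftBy (refShift w))

variable {Dl : List Face} {w : Face}

/-- ★★★ **THE `w₂`-FREE OVER WITNESS ON ITS OWN BLOCK, EVERY POSITION** (no cell below the far cell's row `w.2 − 1` is
needed). [cite: GlazmanManolescu2019, §1 (Fig. 2), §4.2, Lemma 2.1] [cite: Glazman2015WeightedSAW, Lemma 3.1 (proof, pp. 6–7)]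
[cite: CourantRobbins1958, Ch. V Appendix §2 (the even–odd rule)] -/
theorem exists_over_w2free_of_overBlockW (hB : ∀ c ∈ overBlockW w, c ∈ Dl)
    (hr : RootedFace (dom Dl) (w.side .W) (farW w)) (θ : ℝ) :
    ∃ (ω : ΩG (dom Dl) (w.side .W) (farW w)) (h : ω.IsB2a), ω.2.firstSideG = .N ∧
      ω.WE (fun _ => θ) ≠ excursionWinding θ ω.2.firstSideG (ω.z1 hr h) ω.1 ∧ ω.2.W2FreeOff (farW w) := by
  have hB₀ := block42_mem_of_block_mem (B := overBlockW42) hB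
  obtain ⟨hF, hn, hfc, hnth, hfree, hodd⟩ := ωOW_cert
  let ω₀ : ΩG (dom (Dl.map (Face.shiftBy (-refShift w)))) (w42.side .W) (farW w42) :=
    ⟨.S, overW42.mapDomain fun c hc => hB₀ c hc⟩
  have hF' : ω₀.2.firstHitG = 4 := hF
  have hn' : ω₀.2.arcs.length = 18 := hn
  have h₀ : ω₀.IsB2a := by
    refine ΩG.isB2a_of_forall_fc_ne (by rw [hF', hn']; omega) fun j hj1 hj2 => ?_
    rw [hF'] at hj1
    rw [hn'] at hj2
    exact hfc j hj2 hj1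
  have hM : ω₀.Mv = 14 := by unfold ΩG.Mv; rw [hF', hn']
  exact exists_wound_witness_shift (shiftBy_refShift_root w) (shiftBy_refShift_farW w) hr
    (fun γ r => γ.W2FreeOff r) (fun hm _ hf => YBWalk.W2FreeOff_of_mids_shift hm hf) ω₀ h₀
    (by rw [hF']; exact hnth) hfree (by rw [hM, hF']; exact hodd) θ

/-- ★★★ **THE `w₁`-FREE OVER WITNESS ON ITS OWN BLOCK, EVERY POSITION.** [cite: GlazmanManolescu2019, §1 (remark after eq. (1)), §4.2, Lemma 2.1]
[cite: Glazman2015WeightedSAW, Lemma 3.1 (proof, pp. 6–7)] [cite: CourantRobbins1958, Ch. V Appendix §2 (the even–odd rule)] -/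
theorem exists_over_w1free_of_overBlockE (hB : ∀ c ∈ overBlockE w, c ∈ Dl)
    (hr : RootedFace (dom Dl) (w.side .W) (farW w)) (θ : ℝ) :
    ∃ (ω : ΩG (dom Dl) (w.side .W) (farW w)) (h : ω.IsB2a), ω.2.firstSideG = .N ∧
      ω.WE (fun _ => θ) ≠ excursionWinding θ ω.2.firstSideG (ω.z1 hr h) ω.1 ∧ ω.2.W1FreeOff (farW w) := by
  have hB₀ := block42_mem_of_block_mem (B := overBlockE42) hB
  obtain ⟨hF, hn, hfc, hnth, hfree, hodd⟩ := ωOE_cert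
  let ω₀ : ΩG (dom (Dl.map (Face.shiftBy (-refShift w)))) (w42.side .W) (farW w42) :=
    ⟨.S, overE42.mapDomain fun c hc => hB₀ c hc⟩
  have hF' : ω₀.2.firstHitG = 4 := hF
  have hn' : ω₀.2.arcs.length = 18 := hn
  have h₀ : ω₀.IsB2a := by
    refine ΩG.isB2a_of_forall_fc_ne (by rw [hF', hn']; omega) fun j hj1 hj2 => ?_
    rw [hF'] at hj1
    rw [hn'] at hj2
    exact hfc j hj2 hj1
  have hM : ω₀.Mv = 14 := by unfold ΩG.Mv; rw [hF', hn']
  exact exists_wound_witness_shift (shiftBy_refShift_root w) (shiftBy_refShift_farW w) hr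
    (fun γ r => γ.W1FreeOff r) (fun hm _ hf => YBWalk.W1FreeOff_of_mids_shift hm hf) ω₀ h₀
    (by rw [hF']; exact hnth) hfree (by rw [hM, hF']; exact hodd) θ

end OverBlocks

/-! ## §3 A thin side forces `Im VF > 0` at both hexagonal angles -/

section ThinSigns

variable {Dl : List Face} {w : Face}

/-- ★★★★ **THIN SIDE ⇒ `Im VF(π/3) > 0`.** Hole, `K_S2` and the cell below `farSW w` absent, no western door of the far
cell's column below the kill row, and the `w₂`-free over block present ⇒ at the honeycomb angle the imaginary part of the
far-cell defect is strictly positive (`M_S = 0` because the under route is EMPTY, `M_N > 0`).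
[cite: GlazmanManolescu2019, Lemma 2.1 (statement, "in the form given in [Gl]"), §1 (Fig. 2)]
[cite: Glazman2015WeightedSAW, Lemma 3.1 (proof, pp. 6–7)] [cite: CourantRobbins1958, Ch. V Appendix §2 (the even–odd rule)] -/
theorem im_vertexFunctional_printed_pi_div_three_pos_of_thinS (hB : ∀ c ∈ overBlockW w, c ∈ Dl)
    (hf : farW w ∈ Dl) (hh : holeFaceW w ∉ dom Dl) (hKS : killSW w ∉ dom Dl) (hT : ((w.1 - 2, w.2 - 2) : Face) ∉ dom Dl)
    (hcolS : ∀ y : ℤ, y ≤ w.2 - 3 → (w.1 - 3, y) ∉ dom Dl ∨ (w.1 - 2, y) ∉ dom Dl) :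
    0 < (vertexFunctional (printedWeights (π / 3)) tFiveEighths (ybCoeff (π / 3)) Dl (w.side .W) (farW w)).im := by
  have hr : RootedFace (dom Dl) (w.side .W) (farW w) := ⟨hf, fun hb => hh (by rw [root_faces_W] at hb; exact hb.1)⟩
  exact im_vertexFunctional_printed_farCellW_pi_div_three_pos_of_under_killed Dl w hf hh hr
    (ΩG.under_killed_both_of_thinS hh hKS hcolS hT hr _).1 (exists_over_w2free_of_overBlockW hB hr _)

/-- ★★★★ **THIN SIDE ⇒ `Im VF(2π/3) > 0`** — the SAME strict sign at the dual hexagonal angle (with the `w₁`-free over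
block): no kill-forced zero, no sign change between the ends of the hexagonal range.
[cite: GlazmanManolescu2019, Lemma 2.1 (statement, "in the form given in [Gl]"), §1 (remark after eq. (1))]
[cite: Glazman2015WeightedSAW, Lemma 3.1 (proof, pp. 6–7)] [cite: CourantRobbins1958, Ch. V Appendix §2 (the even–odd rule)] -/
theorem im_vertexFunctional_printed_two_pi_div_three_pos_of_thinS (hB : ∀ c ∈ overBlockE w, c ∈ Dl)
    (hf : farW w ∈ Dl) (hh : holeFaceW w ∉ dom Dl) (hKS : killSW w ∉ dom Dl) (hT : ((w.1 - 2, w.2 - 2) : Face) ∉ dom Dl)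
    (hcolS : ∀ y : ℤ, y ≤ w.2 - 3 → (w.1 - 3, y) ∉ dom Dl ∨ (w.1 - 2, y) ∉ dom Dl) :
    0 < (vertexFunctional (printedWeights (2 * π / 3)) tFiveEighths (ybCoeff (2 * π / 3)) Dl (w.side .W)
      (farW w)).im := by
  have hr : RootedFace (dom Dl) (w.side .W) (farW w) := ⟨hf, fun hb => hh (by rw [root_faces_W] at hb; exact hb.1)⟩
  exact im_vertexFunctional_printed_farCellW_two_pi_div_three_pos_of_under_killed Dl w hf hh hr
    (ΩG.under_killed_both_of_thinS hh hKS hcolS hT hr _).2 (exists_over_w1free_of_overBlockE hB hr _)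

/-- ★★★★ **THIN SIDE ⇒ `Im VF(θ) ≥ 0` ON THE WHOLE HEXAGONAL RANGE.** With the under route empty the far-cell law reads
`Im VF(θ) = v(θ) · M_N(θ) ≥ 0` for every `θ ∈ [π/3, 2π/3]`: the far-cell defect NEVER changes sign on the range (and is
strictly positive at both ends by the two theorems above). [cite: GlazmanManolescu2019, Lemma 2.1 (statement, "in the form given in [Gl]"), eq. (1)]
[cite: Glazman2015WeightedSAW, Lemma 3.1 (proof, pp. 6–7)] -/
theorem im_vertexFunctional_printed_nonneg_of_thinS {θ : ℝ} (hθ : θ ∈ Set.Icc (π / 3) (2 * π / 3))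
    (hf : farW w ∈ Dl) (hh : holeFaceW w ∉ dom Dl) (hKS : killSW w ∉ dom Dl) (hT : ((w.1 - 2, w.2 - 2) : Face) ∉ dom Dl)
    (hcolS : ∀ y : ℤ, y ≤ w.2 - 3 → (w.1 - 3, y) ∉ dom Dl ∨ (w.1 - 2, y) ∉ dom Dl) :
    0 ≤ (vertexFunctional (printedWeights θ) tFiveEighths (ybCoeff θ) Dl (w.side .W) (farW w)).im := by
  have hr : RootedFace (dom Dl) (w.side .W) (farW w) := ⟨hf, fun hb => hh (by rw [root_faces_W] at hb; exact hb.1)⟩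
  rw [vertexFunctional_printed_farCellW_im_eq hθ Dl w hf hh hr, ΩG.sum_routeMassW_S_eq_zero_of_thinS hh hKS hcolS hT hr θ,
    sub_zero]
  exact mul_nonneg (weightV_nonneg hθ) (Finset.sum_nonneg fun ω _ => ΩG.routeMassW_nonneg hθ hr .N ω)

/-- ★★★★★ **THIN SIDE ⇒ `Im VF(θ) > 0` FOR EVERY `θ ∈ [π/3, 2π/3]`: THE FAR-CELL DEFECT NEVER VANISHES ON THE HEXAGONAL
RANGE.** Hole, `K_S2` and the cell below `farSW w` absent, no western door below the kill row, both over blocks present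
(19 cells in the rows `w.2 − 1 … w.2 + 2`): `M_S(θ) = 0` (the under route is empty) and `M_N(θ) > 0` (the block's wound
over-walk; every walk weighs positively in the open range, the `w₂`-free and `w₁`-free witnesses at the two ends).
[cite: GlazmanManolescu2019, Lemma 2.1 (statement, "in the form given in [Gl]"), §1 eq. (1)]
[cite: Glazman2015WeightedSAW, Lemma 3.1 (proof, pp. 6–7)] [cite: CourantRobbins1958, Ch. V Appendix §2 (the even–odd rule)] -/
theorem im_vertexFunctional_printed_pos_of_thinS {θ : ℝ} (hθ : θ ∈ Set.Icc (π / 3) (2 * π / 3))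
    (hBW : ∀ c ∈ overBlockW w, c ∈ Dl) (hBE : ∀ c ∈ overBlockE w, c ∈ Dl)
    (hf : farW w ∈ Dl) (hh : holeFaceW w ∉ dom Dl) (hKS : killSW w ∉ dom Dl) (hT : ((w.1 - 2, w.2 - 2) : Face) ∉ dom Dl)
    (hcolS : ∀ y : ℤ, y ≤ w.2 - 3 → (w.1 - 3, y) ∉ dom Dl ∨ (w.1 - 2, y) ∉ dom Dl) :
    0 < (vertexFunctional (printedWeights θ) tFiveEighths (ybCoeff θ) Dl (w.side .W) (farW w)).im := by
  rcases eq_or_lt_of_le hθ.1 with e1 | h1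
  · rw [← e1]; exact im_vertexFunctional_printed_pi_div_three_pos_of_thinS hBW hf hh hKS hT hcolS
  rcases eq_or_lt_of_le hθ.2 with e2 | h2
  · rw [e2]; exact im_vertexFunctional_printed_two_pi_div_three_pos_of_thinS hBE hf hh hKS hT hcolS
  have hr : RootedFace (dom Dl) (w.side .W) (farW w) := ⟨hf, fun hb => hh (by rw [root_faces_W] at hb; exact hb.1)⟩
  have hθo : θ ∈ Set.Ioo (π / 3) (2 * π / 3) := ⟨h1, h2⟩
  rw [vertexFunctional_printed_farCellW_im_eq hθ Dl w hf hh hr, ΩG.sum_routeMassW_S_eq_zero_of_thinS hh hKS hcolS hT hr θ,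
    sub_zero]
  obtain ⟨ω, h, hN, hW, -⟩ := exists_over_w2free_of_overBlockW hBW hr θ
  exact mul_pos (weightV_pos_of_mem_Ioo ⟨by linarith [hθo.1, Real.pi_pos], by linarith [hθo.2, Real.pi_pos]⟩)
    (ΩG.sum_routeMassW_pos_of_wound hr .N hθo ⟨ω, h, hN, hW⟩)

/-- ★★★★★ **THIN SIDE ⇒ THE YANG–BAXTER VERTEX FUNCTIONAL AT THE FAR CELL HAS NO ZERO ON `[π/3, 2π/3]`.**
[cite: GlazmanManolescu2019, Lemma 2.1 (statement, "in the form given in [Gl]")] [cite: Glazman2015WeightedSAW, Lemma 3.1 (proof, pp. 6–7)] -/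
theorem vertexFunctional_printed_ne_zero_of_thinS {θ : ℝ} (hθ : θ ∈ Set.Icc (π / 3) (2 * π / 3))
    (hBW : ∀ c ∈ overBlockW w, c ∈ Dl) (hBE : ∀ c ∈ overBlockE w, c ∈ Dl)
    (hf : farW w ∈ Dl) (hh : holeFaceW w ∉ dom Dl) (hKS : killSW w ∉ dom Dl) (hT : ((w.1 - 2, w.2 - 2) : Face) ∉ dom Dl)
    (hcolS : ∀ y : ℤ, y ≤ w.2 - 3 → (w.1 - 3, y) ∉ dom Dl ∨ (w.1 - 2, y) ∉ dom Dl) :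
    vertexFunctional (printedWeights θ) tFiveEighths (ybCoeff θ) Dl (w.side .W) (farW w) ≠ 0 := by
  intro e
  have hpos := im_vertexFunctional_printed_pos_of_thinS hθ hBW hBE hf hh hKS hT hcolS
  rw [e, Complex.zero_im] at hpos
  exact lt_irrefl _ hpos

end ThinSigns

/-! ## §3b The two under witnesses on their own blocks (rows `w.2 − 2 … w.2 + 1`) and the thin TOP side -/

section UnderBlocks

/-- The 16 cells visited by the schema leaf's `w₁`-free under witness (`deadEndUnderMids`): rows `0 … 3` only.
[cite: GlazmanManolescu2019, §2.1 (finite domains of faces)] -/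
def underBlockW42 : List Face :=
  [(1,1),(1,2),(2,0),(2,1),(2,2),(2,3),(3,0),(3,1),(3,3),(4,0),(4,1),(4,2),(4,3),(5,0),(5,1),(5,2)]

/-- The 17 cells visited by the schema leaf's `w₂`-free under witness (`underMids`): rows `0 … 3` only.
[cite: GlazmanManolescu2019, §2.1 (finite domains of faces)] -/
def underBlockE42 : List Face :=
  [(1,0),(1,1),(1,2),(2,0),(2,1),(2,2),(2,3),(3,0),(3,1),(3,3),(4,0),(4,1),(4,2),(4,3),(5,1),(5,2),(5,3)]

/-- The `w₁`-free under witness drawn in its own block. [cite: GlazmanManolescu2019, §1 (definition of the model), Fig. 1] -/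
def underW42 : YBWalk (dom underBlockW42) (w42.side .W) ((farW w42).side .N) where
  mids := deadEndUnderMids
  head_eq := by decide
  getLast_eq := by decide
  nodup := by decide
  arc_mem := arc_mem_of_check (by decide)
  isChain := by decide
  noncross := noncross_of_check (by decide)

/-- The `w₂`-free under witness drawn in its own block. [cite: GlazmanManolescu2019, §1 (definition of the model), Fig. 1] -/
def underE42 : YBWalk (dom underBlockE42) (w42.side .W) ((farW w42).side .N) where
  mids := underMids
  head_eq := by decide
  getLast_eq := by decide
  nodup := by decide
  arc_mem := arc_mem_of_check (by decide)
  isChain := by decide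
  noncross := noncross_of_check (by decide)

/-- The labelled `w₁`-free under witness. [cite: Glazman2015WeightedSAW, Lemma 3.1 (proof, pp. 6–7)] -/
def ωUW : ΩG (dom underBlockW42) (w42.side .W) (farW w42) := ⟨.N, underW42⟩

/-- The labelled `w₂`-free under witness. [cite: Glazman2015WeightedSAW, Lemma 3.1 (proof, pp. 6–7)] -/
def ωUE : ΩG (dom underBlockE42) (w42.side .W) (farW w42) := ⟨.N, underE42⟩

/-- Certificates of the `w₁`-free under witness on its own block. [cite: Glazman2015WeightedSAW, Lemma 3.1 (proof, pp. 6–7)]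
[cite: CourantRobbins1958, Ch. V Appendix §2 (the even–odd rule)] -/
theorem ωUW_cert : ωUW.2.firstHitG = 4 ∧ ωUW.2.arcs.length = 18 ∧ (∀ j < 18, 4 < j → ωUW.2.fc j ≠ farW w42) ∧
    ωUW.2.nth 4 = (farW w42).side .S ∧ ωUW.2.W1FreeOff (farW w42) ∧
    Odd ((Finset.range 14).filter fun j => eastRayB w42 (ωUW.2.nth (4 + j + 1)) = true).card := by
  refine ⟨by decide, by decide, by decide, by decide, by unfold YBWalk.W1FreeOff; decide, by decide⟩

/-- Certificates of the `w₂`-free under witness on its own block. [cite: Glazman2015WeightedSAW, Lemma 3.1 (proof, pp. 6–7)]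
[cite: CourantRobbins1958, Ch. V Appendix §2 (the even–odd rule)] -/
theorem ωUE_cert : ωUE.2.firstHitG = 4 ∧ ωUE.2.arcs.length = 18 ∧ (∀ j < 18, 4 < j → ωUE.2.fc j ≠ farW w42) ∧
    ωUE.2.nth 4 = (farW w42).side .S ∧ ωUE.2.W2FreeOff (farW w42) ∧
    Odd ((Finset.range 14).filter fun j => eastRayB w42 (ωUE.2.nth (4 + j + 1)) = true).card := by
  refine ⟨by decide, by decide, by decide, by decide, by unfold YBWalk.W2FreeOff; decide, by decide⟩

/-- The `w₁`-free under witness's block at `w`. [cite: GlazmanManolescu2019, §2.1, §4.2 (translation invariance)] -/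
def underBlockW (w : Face) : List Face := underBlockW42.map (Face.shiftBy (refShift w))

/-- The `w₂`-free under witness's block at `w`. [cite: GlazmanManolescu2019, §2.1, §4.2 (translation invariance)] -/
def underBlockE (w : Face) : List Face := underBlockE42.map (Face.shiftBy (refShift w))

variable {Dl : List Face} {w : Face}

/-- ★★★ **THE `w₁`-FREE UNDER WITNESS ON ITS OWN BLOCK, EVERY POSITION** (no cell above the far cell's row `w.2 + 1` is
needed). [cite: GlazmanManolescu2019, §1 (remark after eq. (1)), §4.2, Lemma 2.1] [cite: Glazman2015WeightedSAW, Lemma 3.1 (proof, pp. 6–7)]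
[cite: CourantRobbins1958, Ch. V Appendix §2 (the even–odd rule)] -/
theorem exists_under_w1free_of_underBlockW (hB : ∀ c ∈ underBlockW w, c ∈ Dl)
    (hr : RootedFace (dom Dl) (w.side .W) (farW w)) (θ : ℝ) :
    ∃ (ω : ΩG (dom Dl) (w.side .W) (farW w)) (h : ω.IsB2a), ω.2.firstSideG = .S ∧
      ω.WE (fun _ => θ) ≠ excursionWinding θ ω.2.firstSideG (ω.z1 hr h) ω.1 ∧ ω.2.W1FreeOff (farW w) := by
  have hB₀ := block42_mem_of_block_mem (B := underBlockW42) hB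
  obtain ⟨hF, hn, hfc, hnth, hfree, hodd⟩ := ωUW_cert
  let ω₀ : ΩG (dom (Dl.map (Face.shiftBy (-refShift w)))) (w42.side .W) (farW w42) :=
    ⟨.N, underW42.mapDomain fun c hc => hB₀ c hc⟩
  have hF' : ω₀.2.firstHitG = 4 := hF
  have hn' : ω₀.2.arcs.length = 18 := hn
  have h₀ : ω₀.IsB2a := by
    refine ΩG.isB2a_of_forall_fc_ne (by rw [hF', hn']; omega) fun j hj1 hj2 => ?_
    rw [hF'] at hj1
    rw [hn'] at hj2
    exact hfc j hj2 hj1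
  have hM : ω₀.Mv = 14 := by unfold ΩG.Mv; rw [hF', hn']
  exact exists_wound_witness_shift (shiftBy_refShift_root w) (shiftBy_refShift_farW w) hr
    (fun γ r => γ.W1FreeOff r) (fun hm _ hf => YBWalk.W1FreeOff_of_mids_shift hm hf) ω₀ h₀
    (by rw [hF']; exact hnth) hfree (by rw [hM, hF']; exact hodd) θ

/-- ★★★ **THE `w₂`-FREE UNDER WITNESS ON ITS OWN BLOCK, EVERY POSITION.** [cite: GlazmanManolescu2019, §1 (Fig. 2), §4.2, Lemma 2.1]
[cite: Glazman2015WeightedSAW, Lemma 3.1 (proof, pp. 6–7)] [cite: CourantRobbins1958, Ch. V Appendix §2 (the even–odd rule)] -/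
theorem exists_under_w2free_of_underBlockE (hB : ∀ c ∈ underBlockE w, c ∈ Dl)
    (hr : RootedFace (dom Dl) (w.side .W) (farW w)) (θ : ℝ) :
    ∃ (ω : ΩG (dom Dl) (w.side .W) (farW w)) (h : ω.IsB2a), ω.2.firstSideG = .S ∧
      ω.WE (fun _ => θ) ≠ excursionWinding θ ω.2.firstSideG (ω.z1 hr h) ω.1 ∧ ω.2.W2FreeOff (farW w) := by
  have hB₀ := block42_mem_of_block_mem (B := underBlockE42) hB
  obtain ⟨hF, hn, hfc, hnth, hfree, hodd⟩ := ωUE_cert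
  let ω₀ : ΩG (dom (Dl.map (Face.shiftBy (-refShift w)))) (w42.side .W) (farW w42) :=
    ⟨.N, underE42.mapDomain fun c hc => hB₀ c hc⟩
  have hF' : ω₀.2.firstHitG = 4 := hF
  have hn' : ω₀.2.arcs.length = 18 := hn
  have h₀ : ω₀.IsB2a := by
    refine ΩG.isB2a_of_forall_fc_ne (by rw [hF', hn']; omega) fun j hj1 hj2 => ?_
    rw [hF'] at hj1
    rw [hn'] at hj2
    exact hfc j hj2 hj1
  have hM : ω₀.Mv = 14 := by unfold ΩG.Mv; rw [hF', hn']
  exact exists_wound_witness_shift (shiftBy_refShift_root w) (shiftBy_refShift_farW w) hr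
    (fun γ r => γ.W2FreeOff r) (fun hm _ hf => YBWalk.W2FreeOff_of_mids_shift hm hf) ω₀ h₀
    (by rw [hF']; exact hnth) hfree (by rw [hM, hF']; exact hodd) θ

/-- ★★★★ **THIN TOP SIDE ⇒ `Im VF(π/3) < 0`**: hole, `K_N1` and the cell above `farNW w` absent, no western door of the far
cell's column above the kill row, the `w₂`-free under block present (`M_N = 0`: the over route is EMPTY; `M_S > 0`).
[cite: GlazmanManolescu2019, Lemma 2.1 (statement, "in the form given in [Gl]"), §1 (Fig. 2)]
[cite: Glazman2015WeightedSAW, Lemma 3.1 (proof, pp. 6–7)] [cite: CourantRobbins1958, Ch. V Appendix §2 (the even–odd rule)] -/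
theorem im_vertexFunctional_printed_pi_div_three_neg_of_thinN (hB : ∀ c ∈ underBlockE w, c ∈ Dl)
    (hf : farW w ∈ Dl) (hh : holeFaceW w ∉ dom Dl) (hKN : killNW w ∉ dom Dl) (hT : ((w.1 - 2, w.2 + 2) : Face) ∉ dom Dl)
    (hcolN : ∀ y : ℤ, w.2 + 3 ≤ y → (w.1 - 3, y) ∉ dom Dl ∨ (w.1 - 2, y) ∉ dom Dl) :
    (vertexFunctional (printedWeights (π / 3)) tFiveEighths (ybCoeff (π / 3)) Dl (w.side .W) (farW w)).im < 0 := by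
  have hr : RootedFace (dom Dl) (w.side .W) (farW w) := ⟨hf, fun hb => hh (by rw [root_faces_W] at hb; exact hb.1)⟩
  exact im_vertexFunctional_printed_farCellW_pi_div_three_neg_of_over_killed Dl w hf hh hr
    (ΩG.over_killed_both_of_thinN hh hKN hcolN hT hr _).1 (exists_under_w2free_of_underBlockE hB hr _)

/-- ★★★★ **THIN TOP SIDE ⇒ `Im VF(2π/3) < 0`** (with the `w₁`-free under block).
[cite: GlazmanManolescu2019, Lemma 2.1 (statement, "in the form given in [Gl]"), §1 (remark after eq. (1))]
[cite: Glazman2015WeightedSAW, Lemma 3.1 (proof, pp. 6–7)] [cite: CourantRobbins1958, Ch. V Appendix §2 (the even–odd rule)] -/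
theorem im_vertexFunctional_printed_two_pi_div_three_neg_of_thinN (hB : ∀ c ∈ underBlockW w, c ∈ Dl)
    (hf : farW w ∈ Dl) (hh : holeFaceW w ∉ dom Dl) (hKN : killNW w ∉ dom Dl) (hT : ((w.1 - 2, w.2 + 2) : Face) ∉ dom Dl)
    (hcolN : ∀ y : ℤ, w.2 + 3 ≤ y → (w.1 - 3, y) ∉ dom Dl ∨ (w.1 - 2, y) ∉ dom Dl) :
    (vertexFunctional (printedWeights (2 * π / 3)) tFiveEighths (ybCoeff (2 * π / 3)) Dl (w.side .W)
      (farW w)).im < 0 := by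
  have hr : RootedFace (dom Dl) (w.side .W) (farW w) := ⟨hf, fun hb => hh (by rw [root_faces_W] at hb; exact hb.1)⟩
  exact im_vertexFunctional_printed_farCellW_two_pi_div_three_neg_of_over_killed Dl w hf hh hr
    (ΩG.over_killed_both_of_thinN hh hKN hcolN hT hr _).2 (exists_under_w1free_of_underBlockW hB hr _)

/-- ★★★★ **THIN TOP SIDE ⇒ `Im VF(θ) ≤ 0` ON THE WHOLE HEXAGONAL RANGE** (`Im VF(θ) = −v(θ)·M_S(θ)`).
[cite: GlazmanManolescu2019, Lemma 2.1 (statement, "in the form given in [Gl]"), eq. (1)] [cite: Glazman2015WeightedSAW, Lemma 3.1 (proof, pp. 6–7)] -/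
theorem im_vertexFunctional_printed_nonpos_of_thinN {θ : ℝ} (hθ : θ ∈ Set.Icc (π / 3) (2 * π / 3))
    (hf : farW w ∈ Dl) (hh : holeFaceW w ∉ dom Dl) (hKN : killNW w ∉ dom Dl) (hT : ((w.1 - 2, w.2 + 2) : Face) ∉ dom Dl)
    (hcolN : ∀ y : ℤ, w.2 + 3 ≤ y → (w.1 - 3, y) ∉ dom Dl ∨ (w.1 - 2, y) ∉ dom Dl) :
    (vertexFunctional (printedWeights θ) tFiveEighths (ybCoeff θ) Dl (w.side .W) (farW w)).im ≤ 0 := by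
  have hr : RootedFace (dom Dl) (w.side .W) (farW w) := ⟨hf, fun hb => hh (by rw [root_faces_W] at hb; exact hb.1)⟩
  rw [vertexFunctional_printed_farCellW_im_eq hθ Dl w hf hh hr, ΩG.sum_routeMassW_N_eq_zero_of_thinN hh hKN hcolN hT hr θ,
    zero_sub, mul_neg, neg_nonpos]
  exact mul_nonneg (weightV_nonneg hθ) (Finset.sum_nonneg fun ω _ => ΩG.routeMassW_nonneg hθ hr .S ω)

end UnderBlocks

/-! ## §4 Boxes with the hole one row above the bottom wall -/

section ThinBoxes

variable {m n : ℕ} {h : Face}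

/-- The two over blocks sit in the box whose hole is one row above the bottom wall (`n ≥ 4`).
[cite: GlazmanManolescu2019, §2.1 (finite domains of faces), §4.2 (translation invariance)] -/
theorem overBlocks_hroot_subset_thinBox (hW : 2 ≤ h.1) (hE : h.1 + 3 ≤ m) (hS : h.2 = 1) (hN : h.2 + 3 ≤ n) :
    (∀ c ∈ overBlockW (h.1 + 1, h.2), c ∈ boxMinus m n [h]) ∧ (∀ c ∈ overBlockE (h.1 + 1, h.2), c ∈ boxMinus m n [h]) := by
  have bW : ∀ c ∈ overBlockW42, 1 ≤ c.1 ∧ c.1 ≤ 5 ∧ 1 ≤ c.2 ∧ c.2 ≤ 4 ∧ c ≠ (3, 2) := by decide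
  have bE : ∀ c ∈ overBlockE42, 1 ≤ c.1 ∧ c.1 ≤ 5 ∧ 1 ≤ c.2 ∧ c.2 ≤ 4 ∧ c ≠ (3, 2) := by decide
  constructor
  · intro c hc
    simp only [overBlockW, List.mem_map] at hc
    obtain ⟨a, ha, rfl⟩ := hc
    obtain ⟨b1, b2, b3, b4, b5⟩ := bW a ha
    obtain ⟨x, y⟩ := a
    simp only [ne_eq, Prod.mk.injEq, not_and] at b1 b2 b3 b4 b5
    rw [shiftBy_refShift_mk, mem_boxMinus]
    simp only [List.mem_cons, List.not_mem_nil, or_false]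
    refine ⟨⟨by omega, by omega, by omega, by omega⟩, fun e => ?_⟩
    have e' := Prod.ext_iff.1 e; simp only at e'; omega
  · intro c hc
    simp only [overBlockE, List.mem_map] at hc
    obtain ⟨a, ha, rfl⟩ := hc
    obtain ⟨b1, b2, b3, b4, b5⟩ := bE a ha
    obtain ⟨x, y⟩ := a
    simp only [ne_eq, Prod.mk.injEq, not_and] at b1 b2 b3 b4 b5
    rw [shiftBy_refShift_mk, mem_boxMinus]
    simp only [List.mem_cons, List.not_mem_nil, or_false]
    refine ⟨⟨by omega, by omega, by omega, by omega⟩, fun e => ?_⟩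
    have e' := Prod.ext_iff.1 e; simp only at e'; omega

/-- ★★★★ **THIN BOX: `Im VF(π/3) > 0`.** In the `m × n` box (`n ≥ 4`) with the hole at `(h.1, 1)` — ONE row above the
bottom wall — and `2 ≤ h.1`, `h.1 + 3 ≤ m`, the far-cell defect of the hole root has strictly positive imaginary part at
`θ = π/3`. [cite: GlazmanManolescu2019, Lemma 2.1 (statement, "in the form given in [Gl]"), §2.1]
[cite: Glazman2015WeightedSAW, Lemma 3.1 (proof, pp. 6–7)] -/
theorem thinBox_im_pi_div_three_pos (hW : 2 ≤ h.1) (hE : h.1 + 3 ≤ m) (hS : h.2 = 1) (hN : h.2 + 3 ≤ n) :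
    0 < (vertexFunctional (printedWeights (π / 3)) tFiveEighths (ybCoeff (π / 3)) (boxMinus m n [h])
      (Face.side (h.1 + 1, h.2) .W) (farW (h.1 + 1, h.2))).im := by
  obtain ⟨hBW, -⟩ := overBlocks_hroot_subset_thinBox (m := m) (n := n) hW hE hS hN
  refine im_vertexFunctional_printed_pi_div_three_pos_of_thinS hBW ?_ ?_ ?_ ?_ fun y hy => ?_
  · rw [mem_boxMinus]; simp only [farW, List.mem_cons, List.not_mem_nil, or_false]
    refine ⟨⟨by omega, by omega, by omega, by omega⟩, fun e => ?_⟩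
    have e' := Prod.ext_iff.1 e; simp only at e'; omega
  · rw [holeFaceW_hroot]; exact not_mem_dom_boxMinus_of_mem (by simp)
  · intro hm; have hb := (mem_dom_boxMinus.1 hm).1; simp only [killSW] at hb; omega
  · intro hm; have hb := (mem_dom_boxMinus.1 hm).1; simp only at hb; omega
  · left; intro hm; have hb := (mem_dom_boxMinus.1 hm).1; simp only at hb hy; omega

/-- ★★★★ **THIN BOX: `Im VF(2π/3) > 0`** — the same sign at the dual angle: the hole-root defect of a hole one row above the
wall shows NO kill-forced sign change on the hexagonal range. [cite: GlazmanManolescu2019, Lemma 2.1 (statement, "in the form given in [Gl]"), §2.1]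
[cite: Glazman2015WeightedSAW, Lemma 3.1 (proof, pp. 6–7)] -/
theorem thinBox_im_two_pi_div_three_pos (hW : 2 ≤ h.1) (hE : h.1 + 3 ≤ m) (hS : h.2 = 1) (hN : h.2 + 3 ≤ n) :
    0 < (vertexFunctional (printedWeights (2 * π / 3)) tFiveEighths (ybCoeff (2 * π / 3)) (boxMinus m n [h])
      (Face.side (h.1 + 1, h.2) .W) (farW (h.1 + 1, h.2))).im := by
  obtain ⟨-, hBE⟩ := overBlocks_hroot_subset_thinBox (m := m) (n := n) hW hE hS hN
  refine im_vertexFunctional_printed_two_pi_div_three_pos_of_thinS hBE ?_ ?_ ?_ ?_ fun y hy => ?_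
  · rw [mem_boxMinus]; simp only [farW, List.mem_cons, List.not_mem_nil, or_false]
    refine ⟨⟨by omega, by omega, by omega, by omega⟩, fun e => ?_⟩
    have e' := Prod.ext_iff.1 e; simp only at e'; omega
  · rw [holeFaceW_hroot]; exact not_mem_dom_boxMinus_of_mem (by simp)
  · intro hm; have hb := (mem_dom_boxMinus.1 hm).1; simp only [killSW] at hb; omega
  · intro hm; have hb := (mem_dom_boxMinus.1 hm).1; simp only at hb; omega
  · left; intro hm; have hb := (mem_dom_boxMinus.1 hm).1; simp only at hb hy; omega

/-- ★★★ **THIN BOX: the under route is EMPTY** — no class-`B2a` under-walk at the far cell is wound, at any angle.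
[cite: GlazmanManolescu2019, §1 (Fig. 1, Fig. 2), Lemma 2.1] [cite: Glazman2015WeightedSAW, Lemma 3.1 (proof, pp. 6–7)] -/
theorem thinBox_not_wound_under (hS : h.2 = 1)
    (hr : RootedFace (dom (boxMinus m n [h])) (Face.side (h.1 + 1, h.2) .W) (farW (h.1 + 1, h.2)))
    (ω : ΩG (dom (boxMinus m n [h])) (Face.side (h.1 + 1, h.2) .W) (farW (h.1 + 1, h.2))) (hb : ω.IsB2a)
    (hfs : ω.2.firstSideG = .S) (θ : ℝ) :
    ω.WE (fun _ => θ) = excursionWinding θ ω.2.firstSideG (ω.z1 hr hb) ω.1 := by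
  refine ΩG.WE_eq_excursionWinding_of_under_thinS ?_ ?_ (fun y hy => ?_) ?_ ω hr hb hfs θ
  · rw [holeFaceW_hroot]; exact not_mem_dom_boxMinus_of_mem (by simp)
  · intro hm; have hb' := (mem_dom_boxMinus.1 hm).1; simp only [killSW] at hb'; omega
  · left; intro hm; have hb' := (mem_dom_boxMinus.1 hm).1; simp only at hb' hy; omega
  · intro hm; have hb' := (mem_dom_boxMinus.1 hm).1; simp only at hb'; omega

/-- ★★★★ **THIN BOX: `Im VF(θ) ≥ 0` FOR EVERY `θ ∈ [π/3, 2π/3]`** — no sign change anywhere on the hexagonal range.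
[cite: GlazmanManolescu2019, Lemma 2.1 (statement, "in the form given in [Gl]"), §2.1] -/
theorem thinBox_im_nonneg (hW : 2 ≤ h.1) (hE : h.1 + 3 ≤ m) (hS : h.2 = 1) (hN : h.2 + 3 ≤ n) {θ : ℝ}
    (hθ : θ ∈ Set.Icc (π / 3) (2 * π / 3)) :
    0 ≤ (vertexFunctional (printedWeights θ) tFiveEighths (ybCoeff θ) (boxMinus m n [h])
      (Face.side (h.1 + 1, h.2) .W) (farW (h.1 + 1, h.2))).im := by
  refine im_vertexFunctional_printed_nonneg_of_thinS hθ ?_ ?_ ?_ ?_ fun y hy => ?_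
  · rw [mem_boxMinus]; simp only [farW, List.mem_cons, List.not_mem_nil, or_false]
    refine ⟨⟨by omega, by omega, by omega, by omega⟩, fun e => ?_⟩
    have e' := Prod.ext_iff.1 e; simp only at e'; omega
  · rw [holeFaceW_hroot]; exact not_mem_dom_boxMinus_of_mem (by simp)
  · intro hm; have hb := (mem_dom_boxMinus.1 hm).1; simp only [killSW] at hb; omega
  · intro hm; have hb := (mem_dom_boxMinus.1 hm).1; simp only at hb; omega
  · left; intro hm; have hb := (mem_dom_boxMinus.1 hm).1; simp only at hb hy; omega

/-- ★★★★★ **THIN BOX: `Im VF(θ) > 0` FOR EVERY `θ ∈ [π/3, 2π/3]`** — in the `m × n` box (`n ≥ 4`) with the hole at `(h.1, 1)`,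
one row above the bottom wall (`2 ≤ h.1`, `h.1 + 3 ≤ m`), the far-cell defect of the hole root is strictly positive in
imaginary part on the whole hexagonal range. [cite: GlazmanManolescu2019, Lemma 2.1 (statement, "in the form given in [Gl]"), §2.1] -/
theorem thinBox_im_pos (hW : 2 ≤ h.1) (hE : h.1 + 3 ≤ m) (hS : h.2 = 1) (hN : h.2 + 3 ≤ n) {θ : ℝ}
    (hθ : θ ∈ Set.Icc (π / 3) (2 * π / 3)) :
    0 < (vertexFunctional (printedWeights θ) tFiveEighths (ybCoeff θ) (boxMinus m n [h])
      (Face.side (h.1 + 1, h.2) .W) (farW (h.1 + 1, h.2))).im := by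
  obtain ⟨hBW, hBE⟩ := overBlocks_hroot_subset_thinBox (m := m) (n := n) hW hE hS hN
  refine im_vertexFunctional_printed_pos_of_thinS hθ hBW hBE ?_ ?_ ?_ ?_ fun y hy => ?_
  · rw [mem_boxMinus]; simp only [farW, List.mem_cons, List.not_mem_nil, or_false]
    refine ⟨⟨by omega, by omega, by omega, by omega⟩, fun e => ?_⟩
    have e' := Prod.ext_iff.1 e; simp only at e'; omega
  · rw [holeFaceW_hroot]; exact not_mem_dom_boxMinus_of_mem (by simp)
  · intro hm; have hb := (mem_dom_boxMinus.1 hm).1; simp only [killSW] at hb; omega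
  · intro hm; have hb := (mem_dom_boxMinus.1 hm).1; simp only at hb; omega
  · left; intro hm; have hb := (mem_dom_boxMinus.1 hm).1; simp only at hb hy; omega

/-- ★★★★★ **THIN BOX: NO ZERO OF THE VERTEX FUNCTIONAL AT THE FAR CELL ON `[π/3, 2π/3]`** — in contrast with the
kill-forced zeros of LAW L two rows away from the wall. [cite: GlazmanManolescu2019, Lemma 2.1 (statement, "in the form given in [Gl]"), §2.1] -/
theorem thinBox_vertexFunctional_ne_zero (hW : 2 ≤ h.1) (hE : h.1 + 3 ≤ m) (hS : h.2 = 1) (hN : h.2 + 3 ≤ n) {θ : ℝ}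
    (hθ : θ ∈ Set.Icc (π / 3) (2 * π / 3)) :
    vertexFunctional (printedWeights θ) tFiveEighths (ybCoeff θ) (boxMinus m n [h]) (Face.side (h.1 + 1, h.2) .W)
      (farW (h.1 + 1, h.2)) ≠ 0 := by
  intro e
  have hpos := thinBox_im_pos (m := m) (n := n) hW hE hS hN hθ
  rw [e, Complex.zero_im] at hpos
  exact lt_irrefl _ hpos

/-- The two under blocks sit in the box whose hole is one row below the top wall (`n ≥ 4`).
[cite: GlazmanManolescu2019, §2.1 (finite domains of faces), §4.2 (translation invariance)] -/
theorem underBlocks_hroot_subset_thinTopBox (hW : 2 ≤ h.1) (hE : h.1 + 3 ≤ m) (hS : 2 ≤ h.2) (hN : h.2 + 2 = n) :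
    (∀ c ∈ underBlockW (h.1 + 1, h.2), c ∈ boxMinus m n [h]) ∧ (∀ c ∈ underBlockE (h.1 + 1, h.2), c ∈ boxMinus m n [h]) := by
  have bW : ∀ c ∈ underBlockW42, 1 ≤ c.1 ∧ c.1 ≤ 5 ∧ 0 ≤ c.2 ∧ c.2 ≤ 3 ∧ c ≠ (3, 2) := by decide
  have bE : ∀ c ∈ underBlockE42, 1 ≤ c.1 ∧ c.1 ≤ 5 ∧ 0 ≤ c.2 ∧ c.2 ≤ 3 ∧ c ≠ (3, 2) := by decide
  constructor
  · intro c hc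
    simp only [underBlockW, List.mem_map] at hc
    obtain ⟨a, ha, rfl⟩ := hc
    obtain ⟨b1, b2, b3, b4, b5⟩ := bW a ha
    obtain ⟨x, y⟩ := a
    simp only [ne_eq, Prod.mk.injEq, not_and] at b1 b2 b3 b4 b5
    rw [shiftBy_refShift_mk, mem_boxMinus]
    simp only [List.mem_cons, List.not_mem_nil, or_false]
    refine ⟨⟨by omega, by omega, by omega, by omega⟩, fun e => ?_⟩
    have e' := Prod.ext_iff.1 e; simp only at e'; omega
  · intro c hc
    simp only [underBlockE, List.mem_map] at hc
    obtain ⟨a, ha, rfl⟩ := hc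
    obtain ⟨b1, b2, b3, b4, b5⟩ := bE a ha
    obtain ⟨x, y⟩ := a
    simp only [ne_eq, Prod.mk.injEq, not_and] at b1 b2 b3 b4 b5
    rw [shiftBy_refShift_mk, mem_boxMinus]
    simp only [List.mem_cons, List.not_mem_nil, or_false]
    refine ⟨⟨by omega, by omega, by omega, by omega⟩, fun e => ?_⟩
    have e' := Prod.ext_iff.1 e; simp only at e'; omega

/-- ★★★★ **THIN TOP BOX: `Im VF(π/3) < 0`** — hole at `(h.1, n − 2)`, one row below the top wall of the `m × n` box (`n ≥ 4`,
`2 ≤ h.1`, `h.1 + 3 ≤ m`). [cite: GlazmanManolescu2019, Lemma 2.1 (statement, "in the form given in [Gl]"), §2.1]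
[cite: Glazman2015WeightedSAW, Lemma 3.1 (proof, pp. 6–7)] -/
theorem thinTopBox_im_pi_div_three_neg (hW : 2 ≤ h.1) (hE : h.1 + 3 ≤ m) (hS : 2 ≤ h.2) (hN : h.2 + 2 = n) :
    (vertexFunctional (printedWeights (π / 3)) tFiveEighths (ybCoeff (π / 3)) (boxMinus m n [h])
      (Face.side (h.1 + 1, h.2) .W) (farW (h.1 + 1, h.2))).im < 0 := by
  obtain ⟨-, hBE⟩ := underBlocks_hroot_subset_thinTopBox (m := m) (n := n) hW hE hS hN
  refine im_vertexFunctional_printed_pi_div_three_neg_of_thinN hBE ?_ ?_ ?_ ?_ fun y hy => ?_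
  · rw [mem_boxMinus]; simp only [farW, List.mem_cons, List.not_mem_nil, or_false]
    refine ⟨⟨by omega, by omega, by omega, by omega⟩, fun e => ?_⟩
    have e' := Prod.ext_iff.1 e; simp only at e'; omega
  · rw [holeFaceW_hroot]; exact not_mem_dom_boxMinus_of_mem (by simp)
  · intro hm; have hb := (mem_dom_boxMinus.1 hm).1; simp only [killNW] at hb; omega
  · intro hm; have hb := (mem_dom_boxMinus.1 hm).1; simp only at hb; omega
  · left; intro hm; have hb := (mem_dom_boxMinus.1 hm).1; simp only at hb hy; omega

/-- ★★★★ **THIN TOP BOX: `Im VF(2π/3) < 0`.** [cite: GlazmanManolescu2019, Lemma 2.1 (statement, "in the form given in [Gl]"), §2.1]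
[cite: Glazman2015WeightedSAW, Lemma 3.1 (proof, pp. 6–7)] -/
theorem thinTopBox_im_two_pi_div_three_neg (hW : 2 ≤ h.1) (hE : h.1 + 3 ≤ m) (hS : 2 ≤ h.2) (hN : h.2 + 2 = n) :
    (vertexFunctional (printedWeights (2 * π / 3)) tFiveEighths (ybCoeff (2 * π / 3)) (boxMinus m n [h])
      (Face.side (h.1 + 1, h.2) .W) (farW (h.1 + 1, h.2))).im < 0 := by
  obtain ⟨hBW, -⟩ := underBlocks_hroot_subset_thinTopBox (m := m) (n := n) hW hE hS hN
  refine im_vertexFunctional_printed_two_pi_div_three_neg_of_thinN hBW ?_ ?_ ?_ ?_ fun y hy => ?_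
  · rw [mem_boxMinus]; simp only [farW, List.mem_cons, List.not_mem_nil, or_false]
    refine ⟨⟨by omega, by omega, by omega, by omega⟩, fun e => ?_⟩
    have e' := Prod.ext_iff.1 e; simp only at e'; omega
  · rw [holeFaceW_hroot]; exact not_mem_dom_boxMinus_of_mem (by simp)
  · intro hm; have hb := (mem_dom_boxMinus.1 hm).1; simp only [killNW] at hb; omega
  · intro hm; have hb := (mem_dom_boxMinus.1 hm).1; simp only at hb; omega
  · left; intro hm; have hb := (mem_dom_boxMinus.1 hm).1; simp only at hb hy; omega

end ThinBoxes

/-! ## §5 Two thin sides: the vertex relation HOLDS at the far cell (height-three strips) -/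

section TwoThinSides

variable {Dl : List Face} {w : Face} {m n : ℕ} {h : Face}

/-- ★★★★ **BOTH SIDES THIN ⇒ THE VERTEX FUNCTIONAL VANISHES AT THE FAR CELL, EVERY θ ∈ [π/3, 2π/3].** Hole, both western
kill cells and both cells below `farSW w` / above `farNW w` absent, no western doors of the far cell's column beyond the kill
rows: BOTH routes are empty, so `VF = i·v·(M_N − M_S) = 0` — the Yang–Baxter vertex relation holds EXACTLY at the far cell
although it carries class-`B2a` walks of both routes (none of them wound).
[cite: GlazmanManolescu2019, Lemma 2.1 (statement, "in the form given in [Gl]")] [cite: Glazman2015WeightedSAW, Lemma 3.1 (proof, pp. 6–7)]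
[cite: CourantRobbins1958, Ch. V Appendix §2 (the even–odd rule)] -/
theorem vertexFunctional_printed_eq_zero_of_thinS_thinN {θ : ℝ} (hθ : θ ∈ Set.Icc (π / 3) (2 * π / 3))
    (hf : farW w ∈ Dl) (hh : holeFaceW w ∉ dom Dl) (hKS : killSW w ∉ dom Dl) (hKN : killNW w ∉ dom Dl)
    (hTS : ((w.1 - 2, w.2 - 2) : Face) ∉ dom Dl) (hTN : ((w.1 - 2, w.2 + 2) : Face) ∉ dom Dl)
    (hcolS : ∀ y : ℤ, y ≤ w.2 - 3 → (w.1 - 3, y) ∉ dom Dl ∨ (w.1 - 2, y) ∉ dom Dl)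
    (hcolN : ∀ y : ℤ, w.2 + 3 ≤ y → (w.1 - 3, y) ∉ dom Dl ∨ (w.1 - 2, y) ∉ dom Dl) :
    vertexFunctional (printedWeights θ) tFiveEighths (ybCoeff θ) Dl (w.side .W) (farW w) = 0 := by
  have hr : RootedFace (dom Dl) (w.side .W) (farW w) := ⟨hf, fun hb => hh (by rw [root_faces_W] at hb; exact hb.1)⟩
  rw [vertexFunctional_printed_farCellW_eq hθ Dl w hf hh hr, ΩG.sum_routeMassW_S_eq_zero_of_thinS hh hKS hcolS hTS hr θ,
    ΩG.sum_routeMassW_N_eq_zero_of_thinN hh hKN hcolN hTN hr θ]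
  simp

/-- ★★★★ **HEIGHT-THREE STRIP: the vertex relation holds at the far cell of the hole root for EVERY θ ∈ [π/3, 2π/3]** — the
`m × 3` box with the hole in the middle row, `(h.1, 1)`, `2 ≤ h.1`, `h.1 + 3 ≤ m` (both sides thin).
[cite: GlazmanManolescu2019, Lemma 2.1 (statement, "in the form given in [Gl]"), §2.1] -/
theorem stripThreeBox_vertexFunctional_eq_zero (hW : 2 ≤ h.1) (hE : h.1 + 3 ≤ m) (hS : h.2 = 1) (hN : n = 3) {θ : ℝ}
    (hθ : θ ∈ Set.Icc (π / 3) (2 * π / 3)) :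
    vertexFunctional (printedWeights θ) tFiveEighths (ybCoeff θ) (boxMinus m n [h]) (Face.side (h.1 + 1, h.2) .W)
      (farW (h.1 + 1, h.2)) = 0 := by
  refine vertexFunctional_printed_eq_zero_of_thinS_thinN hθ ?_ ?_ ?_ ?_ ?_ ?_ (fun y hy => ?_) fun y hy => ?_
  · rw [mem_boxMinus]; simp only [farW, List.mem_cons, List.not_mem_nil, or_false]
    refine ⟨⟨by omega, by omega, by omega, by omega⟩, fun e => ?_⟩
    have e' := Prod.ext_iff.1 e; simp only at e'; omega
  · rw [holeFaceW_hroot]; exact not_mem_dom_boxMinus_of_mem (by simp)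
  · intro hm; have hb := (mem_dom_boxMinus.1 hm).1; simp only [killSW] at hb; omega
  · intro hm; have hb := (mem_dom_boxMinus.1 hm).1; simp only [killNW] at hb; omega
  · intro hm; have hb := (mem_dom_boxMinus.1 hm).1; simp only at hb; omega
  · intro hm; have hb := (mem_dom_boxMinus.1 hm).1; simp only at hb; omega
  · left; intro hm; have hb := (mem_dom_boxMinus.1 hm).1; simp only at hb hy; omega
  · left; intro hm; have hb := (mem_dom_boxMinus.1 hm).1; simp only at hb hy; omega

end TwoThinSides

end Literature.Barriers.CriticalPhenomena.PlaquetteWalk
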